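import Summits.BirchSwinnertonDyer.BirchSwinnertonDyer.Theorems.GenusKolyvaginAtTwoPowDvdShaCardAtTwoRTInvariantLostBit
import Summits.BirchSwinnertonDyer.BirchSwinnertonDyer.Theorems.GenusKolyvaginAtTwoPowDvdShaCardAtTwoRTUnramifiedParametrization
import Summits.BirchSwinnertonDyer.BirchSwinnertonDyer.Theorems.GenusKolyvaginAtTwoPowDvdShaCardAtTwoRTRegularFrameAtTwo
import Literature.NumberTheory.EllipticCurves.HeegnerPointsKolyvaginPrimaryCebotarevProofs
import HarnessLib

/-!
# Route `GenusKolyvaginAtTwo`, crux L_T `PowDvdShaCardAtTwoRT` (stmt-BirchSwinnertonDyer-23242), LINE 18 stub KS, the DROPS (exact UP-swap) —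
# THE EXACT ORDER OF AN `s`-EIGEN FUNCTIONAL ON THE LOCAL KUMMER GROUP AT A REGULAR KOLYVAGIN PLACE (`Δ < 0`):
# `addOrderOf (Φ u) = 2^(N_u + N_Φ − (k+1))` — the local core of the sockets `hP7a⁼` / `hP7b⁼` of LEAD's `…RTExactSwapCore`

Seat `bsd-line-gk2-p3` g23 (PROVER seat 3/3, cell `bsd-f1-sign2`), `--supports stmt-BirchSwinnertonDyer-23242` (helper; closes nothing).
THEOREMS ONLY (no definition, no named fact, no `sorry`).  BSD is NOT proved by any of this; neither is the crux nor any stub.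

WHY.  LEAD g18's exact prime swap at `2` (`PlusDescent.exactSwap_core`, `…RTExactSwapCore`, KRR's `primeSwapAtTwoLossy_core_frob_nine` made
lossless on `Δ < 0`) displays two local laws ONE BIT SHARPER than KRR's P7a/P7b: `hP7a` (exponent `a + b − M` instead of `a + b + 1 − M − 2`)
and `hP7b` (exponent `a₀ + b₀ − M − 1` instead of `a₀ + b₀ − M`).  KRR's local P7a (`KolyvaginLowerBoundAtTwo.kummer_eval_pow_smul_ne_zero_at_two`)
loses its bit because for general `Δ` the `s`-eigenpart of `Kum_v` is only `ℤg + (2-torsion)`; on `Δ < 0` at a REGULAR Kolyvagin place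
(`FrobEqFrobInfty`: `τ̃_*` acts on `E[2^k](K̄)` as a complex conjugation, `…RTRegularFrameAtTwo`) the eigenparts are CYCLIC and the exact law of
`…RTInvariantLostBit` applies.  THIS FILE proves the exact local law for an arbitrary additive functional `Φ` on `H¹(K_v, E[2^k])` that is
`s`-eigen on `Kum_v` (`Φ(σ_* a) = s Φ(a)`; e.g. `Φ = ⟨·, y⟩_v` for an `s`-eigen dual class `y`):
* `eigenFunctional_addOrderOf_eval` — pure algebra: on a free rank-one `ℤ/2^k[t]`-module `A = ℤQ₀ ⊕ ℤtQ₀`, an additive `ψ : A → C` with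
  `ψ ∘ t = sψ` and a point `P` with `tP = sP`: `addOrderOf (ψ P) = 2^(N_P + N_ψ − (k+1))`, `2^{N_ψ} = addOrderOf (ψ Q₀)`
  (`invariantLostBit_addOrderOf_pairing_same_sign_of_basis` for the evaluation pairing `A × (A →+ C) → C`, involution `φ ↦ φ ∘ t`);
* **`kummer_eigenFunctional_addOrderOf_at_two`** — at a place `v ∋ ℓ` of the imaginary quadratic `K` over a Zhang–Kolyvagin prime `ℓ` at `2`
  with `1 ≤ k ≤ M(ℓ)`, `FrobEqFrobInfty W K (2^{M'}) ℓ` (`k ≤ M'`), `Δ < 0`, `τ ≠ 1`, `τ • v = v`: for `u ∈ Kum_v` with `σ_* u = s u` there are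
  `N_u` (`addOrderOf u = 2^{N_u}`) and `N_Φ` (the exponent of `Φ` on `Kum_v`: `2^{N_Φ} Φ(Kum_v) = 0`, attained) with
  `addOrderOf (Φ u) = 2^(N_u + N_Φ − (k+1))`;
* `kummer_eigenFunctional_pow_smul_ne_zero_at_two` — **exact P7a, local form**: `2^i u ≠ 0`, `∃ a ∈ Kum_v, 2^j Φ a ≠ 0`, `k ≤ i + j` ⟹
  `2^(i+j−k) Φ u ≠ 0` (KRR's statement with `i + j + 1 − k − 2` replaced by `i + j − k`);
* `kummer_eigenFunctional_pow_smul_eq_zero_at_two` — **exact P7b, local Kummer form**: `2^i u = 0`, `∀ a ∈ Kum_v, 2^j Φ a = 0` ⟹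
  `2^(i+j−k−1) Φ u = 0`.
The global sockets (LEAD's `hP7a`/`hP7b` texts, `localTatePairingZMod`/`weilDualIntertwining` currency) are the sequel files.

References: [Kolyvagin1991MathAnn] §2 (proof of Thm. 2.2), Thm. 2.1; [McCallumLMS1991] §4 Prop. 4.4, §5 Lemma 5.3 and (13);
[GrossLMS1991] §3 (3.2)–(3.3), Prop. 6.2; [Jetchev2008] §3.2 (2)–(3), Prop. 4.2.
-/

set_option autoImplicit false

noncomputable section

open scoped Classical
open Function Field NumberField IsDedekindDomain WeierstrassCurve
open Literature.NumberTheory.EllipticCurves Literature.NumberTheory.GaloisRepresentations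
open Literature.NumberTheory.GaloisCohomology
open Literature.NumberTheory.Automorphic
open Summit.BirchSwinnertonDyer.Rank1Residual.X11b.Relaxation
open Summit.BirchSwinnertonDyer.Rank1Residual.JET.GlobalDuality

-- the Theorems namespace of this sub repeats the summit name by design (D-0017 nested layout)
set_option linter.dupNamespace false

namespace Summit.BirchSwinnertonDyer.BirchSwinnertonDyer.Theorems.GenusExact.PlusDescent

/-! ## §1 Pure algebra: an eigen-functional on a free rank-one `ℤ/2^k[t]`-module -/

section Algebra

variable {A C : Type*} [AddCommGroup A] [AddCommGroup C]

/-- `(2:ℤ)^m • x = (2^m) • x`. [folklore] -/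
theorem two_zpow_smul_eq_nsmul {G : Type*} [AddCommGroup G] (m : ℕ) (x : G) : (2 : ℤ) ^ m • x = (2 ^ m) • x := by
  rw [← natCast_zsmul, Nat.cast_pow, Nat.cast_ofNat]

/-- For `addOrderOf x = 2^N`: `(2:ℤ)^m • x = 0 ↔ N ≤ m`. [folklore] -/
theorem two_zpow_smul_eq_zero_iff_of_addOrderOf {G : Type*} [AddCommGroup G] {x : G} {N : ℕ} (hx : addOrderOf x = 2 ^ N) (m : ℕ) :
    (2 : ℤ) ^ m • x = 0 ↔ N ≤ m := by
  rw [two_zpow_smul_eq_nsmul, ← addOrderOf_dvd_iff_nsmul_eq_zero, hx]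
  exact Nat.pow_dvd_pow_iff_le_right (by norm_num)

/-- **The exact order of an eigen-functional's value at an eigen-point** on a free rank-one `ℤ/2^k[t]`-module `A` (basis `Q₀, tQ₀`,
`t² = 1`): `ψ ∘ t = sψ`, `tP = sP` (`s = ±1`), `addOrderOf P = 2^{N_P}`, `addOrderOf (ψ Q₀) = 2^{N_ψ}` ⟹
`addOrderOf (ψ P) = 2^(N_P + N_ψ − (k + 1))` — the evaluation pairing `A × (A →+ C) → C` is invariant for the involutions `t` and
`φ ↦ φ ∘ t`, so `…RTInvariantLostBit` applies. [cite: Kolyvagin1991MathAnn, §2 (proof of Thm. 2.2)] [cite: McCallumLMS1991, §5 (13)] -/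
theorem eigenFunctional_addOrderOf_eval (t : A →+ A) (ht : ∀ Q, t (t Q) = Q) {k : ℕ} (Q₀ : A)
    (hspan : ∀ Q : A, ∃ a b : ℤ, Q = a • Q₀ + b • t Q₀)
    (hfree : ∀ a b : ℤ, a • Q₀ + b • t Q₀ = 0 → (2 ^ k : ℤ) ∣ a ∧ (2 ^ k : ℤ) ∣ b)
    (htor : (2 ^ k : ℤ) • Q₀ = 0)
    (ψ : A →+ C) {s : ℤ} (hs : s = 1 ∨ s = -1) (hψ : ∀ Q, ψ (t Q) = s • ψ Q)
    {P : A} (hP : t P = s • P) {Nx Ny : ℕ} (hNx : addOrderOf P = 2 ^ Nx) (hNy : addOrderOf (ψ Q₀) = 2 ^ Ny) :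
    addOrderOf (ψ P) = 2 ^ (Nx + Ny - (k + 1)) := by
  -- the involution `φ ↦ φ ∘ t` on `A →+ C` and the (invariant) evaluation pairing
  obtain ⟨σ, hσapp⟩ : ∃ σ : (A →+ C) →+ (A →+ C), ∀ (φ : A →+ C) (Q : A), σ φ Q = φ (t Q) :=
    ⟨AddMonoidHom.compHom' t, fun _ _ ↦ rfl⟩
  obtain ⟨Pev, hPev⟩ : ∃ Pev : A →+ (A →+ C) →+ C, ∀ (Q : A) (φ : A →+ C), Pev Q φ = φ Q :=
    ⟨(AddMonoidHom.id (A →+ C)).flip, fun _ _ ↦ rfl⟩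
  have hσ : ∀ φ, σ (σ φ) = φ := fun φ ↦ by
    ext Q
    rw [hσapp, hσapp, ht]
  have hinv : ∀ Q φ, Pev (t Q) (σ φ) = Pev Q φ := fun Q φ ↦ by rw [hPev, hPev, hσapp, ht]
  have hxy : (t P = P ∧ σ ψ = ψ) ∨ (t P = -P ∧ σ ψ = -ψ) := by
    rcases hs with rfl | rfl
    · left
      refine ⟨by rw [hP, one_zsmul], ?_⟩
      ext Q
      rw [hσapp, hψ, one_zsmul]
    · right
      refine ⟨by rw [hP, neg_one_zsmul], ?_⟩
      ext Q
      rw [hσapp, hψ, neg_one_zsmul, AddMonoidHom.neg_apply]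
  have hPy : addOrderOf (Pev Q₀ ψ) = 2 ^ Ny := by rw [hPev]; exact hNy
  have h := invariantLostBit_addOrderOf_pairing_same_sign_of_basis t ht σ hσ Pev hinv Q₀ hspan hfree htor hxy hNx hPy
  rwa [hPev] at h

end Algebra

/-! ## §2 The exact law on the local Kummer group at a regular Kolyvagin place -/

variable (W : WeierstrassCurve ℚ) (K : Type) [Field K] [NumberField K] [W.IsElliptic] [W.IsGloballyMinimal]

/-- **THE EXACT ORDER OF AN `s`-EIGEN FUNCTIONAL ON `Kum_v` (regular Kolyvagin place, `Δ < 0`).**  `K` imaginary quadratic, `τ ≠ 1`;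
`ℓ` a Zhang–Kolyvagin prime at `2` with `1 ≤ k ≤ M(ℓ)` and `FrobEqFrobInfty W K (2^{M'}) ℓ` (`k ≤ M'`); `v ∋ ℓ`, `τ • v = v`; `Φ` an
additive map on `H¹(K_v, E[2^k])` into a group killed by `2^k` with `Φ(σ_* a) = s Φ(a)` on `Kum_v` (`σ_* = conjActPlace`, `s = ±1`);
`u ∈ Kum_v` with `σ_* u = s u`.  Then there are exponents `N_u`, `N_Φ` with `addOrderOf u = 2^{N_u}`, `2^{N_Φ} Φ(Kum_v) = 0` attained at
some `a₁ ∈ Kum_v`, and **`addOrderOf (Φ u) = 2^(N_u + N_Φ − (k + 1))`** — exactly one bit is lost.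
[cite: Kolyvagin1991MathAnn, §2 (proof of Thm. 2.2)] [cite: McCallumLMS1991, §5 Lemma 5.3 and (13)] [cite: GrossLMS1991, §3 (3.2)] -/
theorem kummer_eigenFunctional_addOrderOf_at_two (hK : IsImaginaryQuadratic K) (hΔ : W.Δ < 0) {k ℓ M' : ℕ} (hk1 : 1 ≤ k)
    (hℓ : Zhang2014.IsKolyvaginPrime (W.conductorNorm ℤ) W K 2 ℓ)
    (hk : k ≤ Zhang2014.kolyvaginIndex W 2 ℓ) (hF : FrobEqFrobInfty W K (2 ^ M') ℓ) (hkM' : k ≤ M')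
    (v : HeightOneSpectrum (𝓞 K)) (hv : (ℓ : 𝓞 K) ∈ v.asIdeal)
    {τ : K ≃ₐ[ℚ] K} (hτ1 : τ ≠ 1) (hfix : τ • v = v) {s : ℤ} (hs : s = 1 ∨ s = -1)
    {C : Type*} [AddCommGroup C] (hC : ∀ c : C, (2 : ℤ) ^ k • c = 0)
    (Φ : galoisCohomology
        (((W.baseChange K).torsionGaloisModule ((2 ^ k : ℕ) : ℤ)).toLocal (Sum.inr v : Place K)) 1 →+ C)
    (hΦ : ∀ a ∈ (W.baseChange K).kummerSelmerStructure ((2 ^ k : ℕ) : ℤ) (Sum.inr v : Place K),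
      Φ (conjActPlace W τ ((2 ^ k : ℕ) : ℤ) hfix a) = s • Φ a)
    {u : galoisCohomology
        (((W.baseChange K).torsionGaloisModule ((2 ^ k : ℕ) : ℤ)).toLocal (Sum.inr v : Place K)) 1}
    (huK : u ∈ (W.baseChange K).kummerSelmerStructure ((2 ^ k : ℕ) : ℤ) (Sum.inr v : Place K))
    (hu : conjActPlace W τ ((2 ^ k : ℕ) : ℤ) hfix u = s • u) :
    ∃ Nu NΦ : ℕ, addOrderOf u = 2 ^ Nu ∧
      (∀ a ∈ (W.baseChange K).kummerSelmerStructure ((2 ^ k : ℕ) : ℤ) (Sum.inr v : Place K), (2 : ℤ) ^ NΦ • Φ a = 0) ∧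
      (∃ a₁ ∈ (W.baseChange K).kummerSelmerStructure ((2 ^ k : ℕ) : ℤ) (Sum.inr v : Place K), addOrderOf (Φ a₁) = 2 ^ NΦ) ∧
      addOrderOf (Φ u) = 2 ^ (Nu + NΦ - (k + 1)) := by
  haveI : Fact (Nat.Prime 2) := ⟨Nat.prime_two⟩
  have hFk : FrobEqFrobInfty W K (2 ^ k) ℓ := FrobEqFrobInfty.of_dvd (pow_dvd_pow 2 hkM') hF
  set σ := conjActPlace W τ ((2 ^ k : ℕ) : ℤ) hfix with hσdef
  set t := (isLiftOfAut_liftAutPlace τ hfix).torsionMap W ((2 ^ k : ℕ) : ℤ) with htdef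
  -- good reduction and `2 ∉ λ`
  obtain ⟨hgood, hpw⟩ := hasGoodReductionAt_of_zhangKolyvaginPrime W K hℓ v hv 1
  have hpw' : ((2 : ℕ) : 𝓞 K) ∉ v.asIdeal := by rwa [pow_one, Int.cast_natCast] at hpw
  -- the unramified parametrisation and the regular frame
  obtain ⟨unr, hunr0, hunrL, hLunr, hunr⟩ :=
    exists_unramified_parametrization_kummer W K hK hℓ hk v hv hpw' hgood τ hfix
  obtain ⟨Q₀, htor, hspan, hfree, ht⟩ := exists_regular_frame_liftAutPlace W K hK hΔ hk1 hℓ hk hFk v hv hτ1 hfix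
  -- the functional pulled back to `E[2^k](K̄)`
  set ψ : geomTorsion (W.baseChange K) ((2 ^ k : ℕ) : ℤ) →+ C := Φ.comp unr with hψdef
  have hψapp : ∀ Q, ψ Q = Φ (unr Q) := fun Q ↦ rfl
  have hψ : ∀ Q, ψ (t Q) = s • ψ Q := fun Q ↦ by
    rw [hψapp, hψapp, hunr, hΦ _ (hunrL Q)]
  -- `u = unr P` with `t P = s P`
  obtain ⟨P, hP⟩ := hLunr u huK
  have htP : t P = s • P := by
    apply hunr0
    rw [hunr, hP, hu, map_zsmul, hP]
  -- the exponents
  have h2P : (2 ^ k) • P = 0 := by simpa using (W.baseChange K).natAbs_nsmul_geomTorsion P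
  obtain ⟨Nu, -, hNu⟩ := (Nat.dvd_prime_pow Nat.prime_two).mp (addOrderOf_dvd_iff_nsmul_eq_zero.mpr h2P)
  have h2ψ : (2 ^ k) • ψ Q₀ = 0 := by rw [← two_zpow_smul_eq_nsmul]; exact hC _
  obtain ⟨NΦ, -, hNΦ⟩ := (Nat.dvd_prime_pow Nat.prime_two).mp (addOrderOf_dvd_iff_nsmul_eq_zero.mpr h2ψ)
  -- every value of `Φ` on `Kum_v` is an integer multiple of `ψ Q₀`
  have hmult : ∀ a ∈ (W.baseChange K).kummerSelmerStructure ((2 ^ k : ℕ) : ℤ) (Sum.inr v : Place K),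
      ∃ c : ℤ, Φ a = c • ψ Q₀ := by
    intro a ha
    obtain ⟨Q, rfl⟩ := hLunr a ha
    obtain ⟨c₁, c₂, rfl⟩ := hspan Q
    refine ⟨c₁ + c₂ * s, ?_⟩
    rw [← hψapp, map_add, map_zsmul, map_zsmul, hψ, add_zsmul, mul_zsmul]
  refine ⟨Nu, NΦ, ?_, ?_, ⟨unr Q₀, hunrL Q₀, ?_⟩, ?_⟩
  · rw [← hP]; exact (addOrderOf_injective unr hunr0 P).trans hNu
  · intro a ha
    obtain ⟨c, hc⟩ := hmult a ha
    rw [hc, smul_comm, two_zpow_smul_eq_nsmul, ← hNΦ, addOrderOf_nsmul_eq_zero, zsmul_zero]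
  · rw [← hψapp]; exact hNΦ
  · rw [← hP, ← hψapp]
    exact eigenFunctional_addOrderOf_eval t ht Q₀ hspan hfree htor ψ hs hψ htP
      ((addOrderOf_injective unr hunr0 P).symm.trans ((addOrderOf_injective unr hunr0 P).trans hNu)) hNΦ

/-- **EXACT P7a, LOCAL FORM** (KRR's `KolyvaginLowerBoundAtTwo.kummer_eval_pow_smul_ne_zero_at_two`, one bit sharper on `Δ < 0`): in the
setting of `kummer_eigenFunctional_addOrderOf_at_two`, `2^i u ≠ 0`, `∃ a ∈ Kum_v, 2^j Φ a ≠ 0` and `k ≤ i + j` give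
**`2^(i + j − k) • Φ u ≠ 0`**. [cite: Kolyvagin1991MathAnn, §2 (proof of Thm. 2.2)] [cite: Jetchev2008, §3.2 (2)–(3), Prop. 4.2] -/
theorem kummer_eigenFunctional_pow_smul_ne_zero_at_two (hK : IsImaginaryQuadratic K) (hΔ : W.Δ < 0) {k ℓ M' : ℕ} (hk1 : 1 ≤ k)
    (hℓ : Zhang2014.IsKolyvaginPrime (W.conductorNorm ℤ) W K 2 ℓ)
    (hk : k ≤ Zhang2014.kolyvaginIndex W 2 ℓ) (hF : FrobEqFrobInfty W K (2 ^ M') ℓ) (hkM' : k ≤ M')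
    (v : HeightOneSpectrum (𝓞 K)) (hv : (ℓ : 𝓞 K) ∈ v.asIdeal)
    {τ : K ≃ₐ[ℚ] K} (hτ1 : τ ≠ 1) (hfix : τ • v = v) {s : ℤ} (hs : s = 1 ∨ s = -1)
    {C : Type*} [AddCommGroup C] (hC : ∀ c : C, (2 : ℤ) ^ k • c = 0)
    (Φ : galoisCohomology
        (((W.baseChange K).torsionGaloisModule ((2 ^ k : ℕ) : ℤ)).toLocal (Sum.inr v : Place K)) 1 →+ C)
    (hΦ : ∀ a ∈ (W.baseChange K).kummerSelmerStructure ((2 ^ k : ℕ) : ℤ) (Sum.inr v : Place K),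
      Φ (conjActPlace W τ ((2 ^ k : ℕ) : ℤ) hfix a) = s • Φ a)
    {u : galoisCohomology
        (((W.baseChange K).torsionGaloisModule ((2 ^ k : ℕ) : ℤ)).toLocal (Sum.inr v : Place K)) 1}
    (huK : u ∈ (W.baseChange K).kummerSelmerStructure ((2 ^ k : ℕ) : ℤ) (Sum.inr v : Place K))
    (hu : conjActPlace W τ ((2 ^ k : ℕ) : ℤ) hfix u = s • u) {i j : ℕ} (hi : (2 : ℤ) ^ i • u ≠ 0)
    (hj : ∃ a ∈ (W.baseChange K).kummerSelmerStructure ((2 ^ k : ℕ) : ℤ) (Sum.inr v : Place K), (2 : ℤ) ^ j • Φ a ≠ 0)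
    (hg : k ≤ i + j) :
    (2 : ℤ) ^ (i + j - k) • Φ u ≠ 0 := by
  obtain ⟨Nu, NΦ, hNu, hΦ0, -, hord⟩ :=
    kummer_eigenFunctional_addOrderOf_at_two W K hK hΔ hk1 hℓ hk hF hkM' v hv hτ1 hfix hs hC Φ hΦ huK hu
  -- `i < N_u` and `j < N_Φ`
  have hiN : i < Nu := by
    by_contra h
    exact hi ((two_zpow_smul_eq_zero_iff_of_addOrderOf hNu i).mpr (not_lt.mp h))
  have hjN : j < NΦ := by
    obtain ⟨a, ha, hja⟩ := hj
    by_contra h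
    apply hja
    obtain ⟨d, hd⟩ := Nat.exists_eq_add_of_le (not_lt.mp h)
    rw [hd, pow_add, mul_comm, mul_zsmul, hΦ0 a ha, zsmul_zero]
  rw [Ne, two_zpow_smul_eq_zero_iff_of_addOrderOf hord]
  omega

/-- **EXACT P7b, LOCAL KUMMER FORM**: in the setting of `kummer_eigenFunctional_addOrderOf_at_two`, `2^i u = 0` and
`∀ a ∈ Kum_v, 2^j Φ a = 0` give **`2^(i + j − k − 1) • Φ u = 0`** (one bit sharper than the free-module bound `2^(i + j − k)`).
[cite: Kolyvagin1991MathAnn, §2 (proof of Thm. 2.2)] [cite: McCallumLMS1991, §5 (13)] -/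
theorem kummer_eigenFunctional_pow_smul_eq_zero_at_two (hK : IsImaginaryQuadratic K) (hΔ : W.Δ < 0) {k ℓ M' : ℕ} (hk1 : 1 ≤ k)
    (hℓ : Zhang2014.IsKolyvaginPrime (W.conductorNorm ℤ) W K 2 ℓ)
    (hk : k ≤ Zhang2014.kolyvaginIndex W 2 ℓ) (hF : FrobEqFrobInfty W K (2 ^ M') ℓ) (hkM' : k ≤ M')
    (v : HeightOneSpectrum (𝓞 K)) (hv : (ℓ : 𝓞 K) ∈ v.asIdeal)
    {τ : K ≃ₐ[ℚ] K} (hτ1 : τ ≠ 1) (hfix : τ • v = v) {s : ℤ} (hs : s = 1 ∨ s = -1)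
    {C : Type*} [AddCommGroup C] (hC : ∀ c : C, (2 : ℤ) ^ k • c = 0)
    (Φ : galoisCohomology
        (((W.baseChange K).torsionGaloisModule ((2 ^ k : ℕ) : ℤ)).toLocal (Sum.inr v : Place K)) 1 →+ C)
    (hΦ : ∀ a ∈ (W.baseChange K).kummerSelmerStructure ((2 ^ k : ℕ) : ℤ) (Sum.inr v : Place K),
      Φ (conjActPlace W τ ((2 ^ k : ℕ) : ℤ) hfix a) = s • Φ a)
    {u : galoisCohomology
        (((W.baseChange K).torsionGaloisModule ((2 ^ k : ℕ) : ℤ)).toLocal (Sum.inr v : Place K)) 1}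
    (huK : u ∈ (W.baseChange K).kummerSelmerStructure ((2 ^ k : ℕ) : ℤ) (Sum.inr v : Place K))
    (hu : conjActPlace W τ ((2 ^ k : ℕ) : ℤ) hfix u = s • u) {i j : ℕ} (hi : (2 : ℤ) ^ i • u = 0)
    (hj : ∀ a ∈ (W.baseChange K).kummerSelmerStructure ((2 ^ k : ℕ) : ℤ) (Sum.inr v : Place K), (2 : ℤ) ^ j • Φ a = 0) :
    (2 : ℤ) ^ (i + j - k - 1) • Φ u = 0 := by
  obtain ⟨Nu, NΦ, hNu, -, ⟨a₁, ha₁, hNΦ⟩, hord⟩ :=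
    kummer_eigenFunctional_addOrderOf_at_two W K hK hΔ hk1 hℓ hk hF hkM' v hv hτ1 hfix hs hC Φ hΦ huK hu
  have hiN : Nu ≤ i := (two_zpow_smul_eq_zero_iff_of_addOrderOf hNu i).mp hi
  have hjN : NΦ ≤ j := (two_zpow_smul_eq_zero_iff_of_addOrderOf hNΦ j).mp (hj a₁ ha₁)
  rw [two_zpow_smul_eq_zero_iff_of_addOrderOf hord]
  omega

end Summit.BirchSwinnertonDyer.BirchSwinnertonDyer.Theorems.GenusExact.PlusDescent

end
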